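import Summits.Ventures.HodgeRepro2.T6InterfaceParity

/-!
# T6InterfacePont — the Pontryagin product of an interface datum by Poincaré duality

Generic construction for the owners' glue into `TransferShadow` (t6-p2 l. 4425, lead l. 4466): given
`intB`, `intBB`, `cop` with the field-shaped properties of the interface (`intB_deg`, `intB_ne_zero` on a
monomial basis, `intBB_tmul`, `cop_ι`), the bilinear map

  `pontDual a b` := the Poincaré dual of `u ↦ ∫_{B×B} (a ⊗ b) ∪ m^* u`

satisfies the field `pont_spec` for ALL `a b u` BY CONSTRUCTION (`pontDual_spec`), and is CHARACTERISED by
it (`eq_pontDual_of_spec`: any `p` with `∫_B p ∪ u = ∫_{B×B} (a ⊗ b) ∪ m^* u` for every `u` equals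
`pontDual a b`; `eq_pontDual_of_spec_even`: for even `a`, `b`, `p` the even-`u` instances suffice). So a
geometric Pontryagin product `m_*(pr_1^* a ∪ pr_2^* b)` known to satisfy the projection formula on EVEN
classes is `pontDual a b` there, and `alg_pont` transports along that equality.

Ingredients: `topCoeff` of a monomial basis `b` of `H¹(B)` with `24` elements (any basis), the scalar
relation `intB = intB e_univ • topCoeff b` (`intB_eq_smul_topCoeff`: both kill every degree `≠ 24` and
`H^{24}` is the line through `e_univ`), and `pairingEquiv b` of `T6ExteriorDuality`.
§8(d): uses an L-value-free non-vanishing device: NO.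
-/

namespace Summit.Ventures.HodgeRepro2.T6.Pont

open ExteriorAlgebra ExteriorDuality GradedTensorProduct Parity
open scoped TensorProduct

variable {K : Type*} [Field K] [NumberField K]
variable {I : Type*} [Fintype I] [LinearOrder I] (b : Module.Basis I ℚ (H1 K))

/-- An element of the top exterior power is `topCoeff u • e_univ`. -/
lemma eq_topCoeff_smul_of_mem_top {u : HB K} (hu : u ∈ degB K (Fintype.card I)) :
    u = topCoeff b u • b.ExteriorAlgebra Finset.univ := by
  classical
  let U : Set.powersetCard I (Fintype.card I) := Set.powersetCard.ofCard (Finset.card_univ (α := I))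
  have hsub : ∀ t : Set.powersetCard I (Fintype.card I), t = U := fun t =>
    Subtype.ext (Finset.eq_univ_of_card _ (Set.powersetCard.card_eq t))
  have h1 := (b.exteriorPower (Fintype.card I)).sum_repr ⟨u, hu⟩
  rw [Finset.sum_eq_single U (fun t _ ht => absurd (hsub t) ht)
    (fun h => absurd (Finset.mem_univ _) h)] at h1
  have h2 : (b.exteriorPower (Fintype.card I)).repr ⟨u, hu⟩ U • b.ExteriorAlgebra Finset.univ
      = u := by
    have := congrArg Subtype.val h1
    rw [Submodule.coe_smul, ← basis_eq_coe_basis] at this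
    exact this
  set c := (b.exteriorPower (Fintype.card I)).repr ⟨u, hu⟩ U with hcdef
  have hc : topCoeff b u = c := by
    calc topCoeff b u = topCoeff b (c • b.ExteriorAlgebra Finset.univ) := by rw [h2]
      _ = c := by rw [map_smul, topCoeff_basis, if_pos rfl, smul_eq_mul, mul_one]
  rw [hc, h2]

section scalar

variable (intB : HB K →ₗ[ℚ] ℚ) (hdeg : ∀ k ≠ 24, ∀ a ∈ degB K k, intB a = 0)
  (hI : Fintype.card I = 24)
include hdeg hI

/-- A functional killing every degree `≠ 24` is a multiple of `topCoeff`: `intB = intB e_univ • topCoeff b`. -/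
lemma intB_eq_smul_topCoeff : intB = intB (b.ExteriorAlgebra Finset.univ) • topCoeff b := by
  refine eq_of_forall_homogeneous fun j u hu => ?_
  rw [LinearMap.smul_apply, smul_eq_mul]
  by_cases hj : j = 24
  · subst hj
    rw [← hI] at hu
    have hu' := eq_topCoeff_smul_of_mem_top b hu
    set c := topCoeff b u
    rw [hu', map_smul, smul_eq_mul, mul_comm]
  · rw [hdeg j hj u hu, topCoeff_of_mem_of_ne b (by omega) hu, mul_zero]

/-- Pointwise form of `intB_eq_smul_topCoeff`. -/
lemma intB_apply_eq (u : HB K) :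
    intB u = intB (b.ExteriorAlgebra Finset.univ) * topCoeff b u := by
  conv_lhs => rw [intB_eq_smul_topCoeff b intB hdeg hI]
  rw [LinearMap.smul_apply, smul_eq_mul]

/-- If `intB` is non-zero on `H^{24}` then `intB e_univ ≠ 0`. -/
lemma intB_univ_ne_zero (hne : ∃ a ∈ degB K 24, intB a ≠ 0) :
    intB (b.ExteriorAlgebra Finset.univ) ≠ 0 := by
  obtain ⟨a, _, ha⟩ := hne
  intro h0
  apply ha
  rw [intB_apply_eq b intB hdeg hI, h0, zero_mul]

end scalar

section pont

variable (intB : HB K →ₗ[ℚ] ℚ) (intBB : HBB K →ₗ[ℚ] ℚ) (cop : HB K →ₐ[ℚ] HBB K)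

/-- `Ψ a b : u ↦ ∫_{B×B} (a ⊗ b) ∪ m^* u`, bilinear in `(a, b)`. -/
noncomputable def psi : HB K →ₗ[ℚ] HB K →ₗ[ℚ] Module.Dual ℚ (HB K) :=
  ((LinearMap.mul ℚ (HBB K)).compl₁₂ (inl K).toLinearMap (inr K).toLinearMap).compr₂
    (((LinearMap.mul ℚ (HBB K)).compl₂ cop.toLinearMap).compr₂ intBB)

/-- `Ψ a b u = ∫_{B×B} (pr_1^* a ∪ pr_2^* b) ∪ m^* u`. -/
lemma psi_apply (a b u : HB K) : psi intBB cop a b u = intBB (inl K a * inr K b * cop u) := rfl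

/-- The Pontryagin product by Poincaré duality: `pontDual a b` is the class with
`∫_B (pontDual a b) ∪ u = Ψ a b u` for all `u` (normalised by `intB e_univ`). -/
noncomputable def pontDual : HB K →ₗ[ℚ] HB K →ₗ[ℚ] HB K :=
  (intB (b.ExteriorAlgebra Finset.univ))⁻¹ • (psi intBB cop).compr₂ (pairingEquiv b).symm.toLinearMap

/-- Unfolding `pontDual`. -/
lemma pontDual_apply (a b' : HB K) : pontDual b intB intBB cop a b' =
    (intB (b.ExteriorAlgebra Finset.univ))⁻¹ • (pairingEquiv b).symm (psi intBB cop a b') := rfl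

variable (hdeg : ∀ k ≠ 24, ∀ a ∈ degB K k, intB a = 0) (hI : Fintype.card I = 24)
  (hne : ∃ a ∈ degB K 24, intB a ≠ 0)
include hdeg hI hne

/-- `pont_spec` holds for `pontDual`, for ALL `a b u`, by construction. -/
theorem pontDual_spec (a b' u : HB K) :
    intB (pontDual b intB intBB cop a b' * u) = intBB (inl K a * inr K b' * cop u) := by
  have hc := intB_univ_ne_zero b intB hdeg hI hne
  rw [pontDual_apply, smul_mul_assoc, map_smul, smul_eq_mul,
    intB_apply_eq b intB hdeg hI ((pairingEquiv b).symm (psi intBB cop a b') * u),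
    topCoeff_pairingEquiv_symm_mul, psi_apply, ← mul_assoc, inv_mul_cancel₀ hc, one_mul]

/-- `pontDual a b` is CHARACTERISED by `pont_spec`: any `p` with `∫_B p ∪ u = ∫_{B×B} (a ⊗ b) ∪ m^* u`
for every `u` equals `pontDual a b`. -/
theorem eq_pontDual_of_spec {a b' p : HB K}
    (hp : ∀ u : HB K, intB (p * u) = intBB (inl K a * inr K b' * cop u)) :
    p = pontDual b intB intBB cop a b' := by
  have hc := intB_univ_ne_zero b intB hdeg hI hne
  by_contra hne'
  obtain ⟨s, hs⟩ := exists_topCoeff_mul_ne_zero b _ (sub_ne_zero.mpr hne')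
  apply hs
  have h1 : intB ((p - pontDual b intB intBB cop a b') * b.ExteriorAlgebra sᶜ) = 0 := by
    rw [sub_mul, map_sub, hp, pontDual_spec b intB intBB cop hdeg hI hne, sub_self]
  rw [intB_apply_eq b intB hdeg hI] at h1
  exact (mul_eq_zero.mp h1).resolve_left hc

/-- The even-class form: for `a ∈ H^{2k}`, `b ∈ H^{2l}`, `p ∈ H^{2m}`, the even-`u` instances of
`pont_spec` already force `p = pontDual a b` (the odd-`u` instances hold by degree). -/
theorem eq_pontDual_of_spec_even
    (htmul : ∀ a b : HB K, intBB (inl K a * inr K b) = intB a * intB b)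
    (hcop : ∀ v : H1 K, cop (ι ℚ v) = inl K (ι ℚ v) + inr K (ι ℚ v))
    {k l m : ℕ} {a b' p : HB K} (ha : a ∈ degB K (2 * k)) (hb : b' ∈ degB K (2 * l))
    (hp : p ∈ degB K (2 * m))
    (heven : ∀ (j : ℕ) (u : HB K), u ∈ degB K (2 * j) →
      intB (p * u) = intBB (inl K a * inr K b' * cop u)) :
    p = pontDual b intB intBB cop a b' :=
  eq_pontDual_of_spec b intB intBB cop hdeg hI hne
    (pont_spec_of_even intB hdeg intBB htmul cop hcop ha hb hp heven)

omit hne in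
/-- Degree bookkeeping: `pontDual a b ∈ H^{2(k + l - 12)}` for `a ∈ H^{2k}`, `b ∈ H^{2l}`. -/
theorem pontDual_mem (htmul : ∀ a b : HB K, intBB (inl K a * inr K b) = intB a * intB b)
    (hcop : ∀ v : H1 K, cop (ι ℚ v) = inl K (ι ℚ v) + inr K (ι ℚ v))
    {k l : ℕ} {a b' : HB K} (ha : a ∈ degB K (2 * k)) (hb : b' ∈ degB K (2 * l)) :
    pontDual b intB intBB cop a b' ∈ degB K (2 * (k + l - 12)) := by
  rw [pontDual_apply]
  refine Submodule.smul_mem _ _ ?_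
  by_cases hkl : 2 * k ≤ 24 ∧ 2 * l ≤ 24
  · have := pairingEquiv_symm_mem b (psi intBB cop a b') (48 - 2 * k - 2 * l) ?_
    · rw [hI] at this
      have heq : 24 - (48 - 2 * k - 2 * l) = 2 * (k + l - 12) := by omega
      rwa [heq] at this
    · intro j hj u hu
      rw [psi_apply]
      exact intBB_inl_mul_inr_mul_cop_eq_zero intB hdeg intBB htmul cop hcop ha hb hu (by omega)
  · have h0 : psi intBB cop a b' = 0 := by
      apply eq_zero_of_forall_comp
      intro j u hu
      rw [psi_apply]
      exact intBB_inl_mul_inr_mul_cop_eq_zero intB hdeg intBB htmul cop hcop ha hb hu (by omega)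
    rw [h0, map_zero]
    exact Submodule.zero_mem _

end pont

end Summit.Ventures.HodgeRepro2.T6.Pont
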